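import Summits.HodgeConjecture.HodgeConjecture.Theorems.UeP4bFlatLevelReadingsPins
import HarnessLib

/-!
# U-e P4 (B2b): the level sections of the universal family read by ONE rational vector through a flat marking family

Cell hodgecm-mathlib (D-0151), rung 0 of the Mumford line under `HDel` (item `stmt-HodgeConjecture-24835`), (U)-HEAD third
layer, node U-e, socket P4, composite (B2) `UHead.Ue_P4b2_flatLevelReading` (P4 lead B-p03, sockets of record
`B-provers/B-p03/Ue-P4-sockets.v0.7.B-p03g13.lean` :722); plan B-p18 (g15), proof B-p16 (g12).  THEOREMS ONLY (no
definition, no named fact, no instance, no `sorry`); books 0.  HC_CM is proved only modulo the 7 printed citations until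
rung 0 closes; nothing here changes that count.

THE STATEMENT (`levelSection_eq_r_of_flatFrame`, NOTION-FREE so that the HOME socket text — which uses the HOME notions
`SiegelMarkingFamily`, `IsFlatIntegralFrame`, `IsMarkingFrame`, `IsFlatLevelReading` — is discharged by unfolding):
for the complexified universal family `f := W1.univFamilyℂ 𝓜 : 𝒳 → M ⊗ ℂ` of a Siegel fine moduli scheme (`M` quasi-projective
over `ℚ`, `M ⊗ ℂ` smooth of pure dimension `d`), a path-connected `W ⊆ (M ⊗ ℂ)(ℂ)` cohomologically
locally trivial for `f`, fibre triples `P′ x` with base-change witnesses `(G x, Ĝ x)` along the `ℚ`-side readings of the points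
`x ∈ W` ([MumfordFogartyKirwan1994] Def. 7.3), markings `mark x` of the identity fibres `A x := ((P′ x).A.fibre 𝟙).toAbelianVariety`
by `[J x, r]` with basis matrices `γ = 1`, and a frame `fr x a ∈ H¹(X_x(ℂ); ℚ)` which is FLAT (★ `transportFun` carries
`fr x a ⊗ 1` to `fr x′ a ⊗ 1` — clause (iii) of `IsFlatIntegralFrame`) and IS the markings' lattice frame through the PINNED
identifications `e x := (fibreAVIso (P′ x) ≪≫ (fiberUnivIsoOfIsBaseChangeVia 𝓜 x (P′ x) (G x) (Ĝ x) (hbc x))⁻¹)(ℂ)` (`IsMarkingFrame`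
unfolded): **if the level section `σᵢ` reads `(mark x₀).r v` at ONE `x₀ ∈ W`, it reads `(mark x).r v` at EVERY `x ∈ W`.**

PROOF = ★ (E2-core) `HodgeTheory.torsionReading_const_of_flatFrame_family` (B-p18 (g15): torsion readings against a flat
frame are constant) at `u x := e x ∘ (mark x).toFun`, `nX := [N] ⊗ ℂ`, `τ := (σᵢ ⊗ ℂ)(ℂ)|_W`, the pins (P3)/(P4) of
`UeP4bFlatLevelReadingsPins` supplying `τ`'s continuity and `hpow`; the `N`-torsion points `σᵢ(x)` are `toFun [w(x)/N]` with
`w(x) ≡ w(x₀) (mod N)`, and `(mark x).r v = toFun [ṽ]` for `γ = 1` (★ `SiegelAdelicMarking.r_eq_toFun_proj_of_γ_eq_one`).  The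
instances ★ (E2-core) wants (`X ⊗ ℂ`, `M ⊗ ℂ` separated, second countable, locally of finite type; `f` smooth proper of relative
dimension `g`) come from (F-c′) by base change (★ `isQuasiProjectiveOver_baseChange_M`, ★ `IsQuasiProjectiveOver.isVarietyPair_ofScheme`,
★ `ComplexPoints.secondCountableTopology_of_compactSpace_holds`) and, for the total space, from the smooth proper `f`
(★ `isSmoothProjectiveFamily_univFamilyℂ_of_classify`; so the binder `IsQuasiProjectiveOver (univTotal 𝓜)` is NOT needed and
the binders are exactly those of the socket text v0.7/v0.8 :722/:729).

## References
* [MumfordFogartyKirwan1994] D. Mumford, J. Fogarty, F. Kirwan, *Geometric Invariant Theory*, 3rd ed. (1994), Ch. 7 §2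
  Definition 7.2 (p. 129), Definition 7.3 (p. 129), §3 Theorem 7.9 (p. 139).
* [Milne2005ShimuraVarieties] J. S. Milne, *Introduction to Shimura Varieties* (2005), §6 Thm. 6.11 pp. 74–75, §12 (63) p. 116.
* [VoisinHodgeI2002] C. Voisin, *Hodge Theory and Complex Algebraic Geometry I*, CUP (2002), §9.2.1 (pp. 229–231).
-/

set_option autoImplicit false

-- mandated namespace `Summit.HodgeConjecture.HodgeConjecture.Theorems` trips `linter.dupNamespace` (single-problem summit; the lakefile turns
-- the linter off tree-wide as a weak option), restated here so stand-alone elaboration is warning-free (as in ★ `SiegelUniversalFamilyHodgeFrames`).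
set_option linter.dupNamespace false

noncomputable section

open CategoryTheory CategoryTheory.Limits AlgebraicGeometry MonoidalCategory CartesianMonoidalCategory
open _root_.Topology _root_.Filter
open scoped MonObj

namespace Summit.HodgeConjecture.HodgeConjecture.Theorems

namespace UnivFamilyLevelReadings

open Literature.AlgebraicGeometry
open Literature.AlgebraicGeometry.Motives
open Literature.AlgebraicGeometry.HodgeTheory
open Literature.AlgebraicGeometry.AbelianSchemes (PolarizedAbelianSchemeWithLevel AbelianSchemeOver)
open Literature.AlgebraicGeometry.ModuliOfAbelianVarieties
open Literature.AlgebraicGeometry.ModuliOfAbelianVarieties.W1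
open Literature.AlgebraicTopology.SingularHomology
open Literature.Geometry.Kaehler (ComplexTorus)
open Literature.NumberTheory.Adeles SiegelModuli

universe v u

/-! ### THE HEAD: the level sections read by ONE rational vector through a flat marking family -/

section Head

variable {g N : ℕ} {δ : Fin g → ℕ}

/-- **U-e P4 (B2b): the level sections of the universal family read by ONE rational vector through a flat marking family.**
Setting: the complexified universal family `f := univFamilyℂ 𝓜 : X ⊗ ℂ → M ⊗ ℂ` of a Siegel fine moduli scheme `𝓜` (`M`
quasi-projective over `ℚ`, `M ⊗ ℂ` smooth of pure dimension `d`), a path-connected `W ⊆ (M ⊗ ℂ)(ℂ)`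
cohomologically locally trivial for `f`, fibre triples `P′ x` with base-change witnesses `(G x, Ĝ x)` along the `ℚ`-side
readings of the points `x ∈ W`, markings `mark x` of the identity fibres `((P′ x).A)_𝟙` by `[J x, r]` with basis matrices
`γ = 1`, and a frame `γ x a ∈ H¹(X_x(ℂ); ℚ)` which is FLAT (clause (iii) of the HOME notion `IsFlatIntegralFrame`) and IS the
markings' lattice frame through the PINNED identifications `e x := (fibreAVIso (P′ x) ≪≫ fiberUnivIso⁻¹)(ℂ)` (the HOME notion
`IsMarkingFrame`, unfolded).  CLAIM: if the level section `σᵢ` reads `(mark x₀).r v` at ONE `x₀ ∈ W`, it reads `(mark x).r v` at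
EVERY `x ∈ W`.  PROOF: ★ (E2-core) `torsionReading_const_of_flatFrame_family` at `u x := e x ∘ (mark x).toFun`, `nX := [N] ⊗ ℂ`,
`τ := (σᵢ ⊗ ℂ)(ℂ)|_W` (pins (P3) `map_fiberι_pinned_restrictPt`, (P4) `map_fiberι_pinned_pow`): the `N`-torsion points `σᵢ(x)`
are `toFun [w(x)/N]` with `w(x) ≡ w(x₀) (mod N)`, and `(mark x).r v = toFun [ṽ]` for `γ = 1` (★ `r_eq_toFun_proj_of_γ_eq_one`).
[cite: MumfordFogartyKirwan1994, Ch. 7 §2 Definition 7.2 (p. 129), Definition 7.3 (p. 129) and §3 Theorem 7.9 (p. 139)]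
[cite: Milne2005ShimuraVarieties, §6 Thm. 6.11 pp. 74–75 and §12 (63) p. 116] [cite: VoisinHodgeI2002, §9.2.1] -/
theorem levelSection_eq_r_of_flatFrame (hN : 3 ≤ N) (𝓜 : SiegelFineModuliScheme g N δ) (r : gspFinAdelic δ)
    (d : ℕ) [SmoothOfRelativeDimension d ((Motives.baseChange ℚ ℂ).obj 𝓜.M).hom]
    (hMq : IsQuasiProjectiveOver 𝓜.M) :
    haveI : IsLocallyNoetherian (specOver ℚ ℂ).left :=
      inferInstanceAs (IsLocallyNoetherian (Spec (CommRingCat.of ℂ)))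
    ∀ (W : Set (ComplexPoints ((Motives.baseChange ℚ ℂ).obj 𝓜.M))) (_hW : IsPathConnected W)
      (hU : IsCohomologicallyLocallyTrivialOn (univFamilyℂ 𝓜) W)
      (P' : W → PolarizedAbelianSchemeWithLevel g N δ (specOver ℚ ℂ).left)
      (G : ∀ x : W, (P' x).A.X.left ⟶ 𝓜.univ.A.X.left) (Ĝ : ∀ x : W, (P' x).D.hat.X.left ⟶ 𝓜.univ.D.hat.X.left)
      (hbc : ∀ x : W, (P' x).IsBaseChangeVia 𝓜.univ
        ((AlgPoints.baseChangeEquiv (algebraMap ℚ ℂ) 𝓜.M).symm x.1).left (G x) (Ĝ x))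
      (J : W → C0pm δ)
      (mark : ∀ x : W, SiegelAdelicMarking (J x) r ((P' x).A.fibre (𝟙 (Spec (CommRingCat.of ℂ)))).toAbelianVariety)
      (_hγ1 : ∀ x, (mark x).γ = 1)
      (fr : ∀ x : W, Fin g ⊕ Fin g →
        singularCohomology ℚ ℚ (ComplexPoints (fiberOver (univFamilyℂ 𝓜) x.1)) 1),
      (∀ (x x' : W) (p : Path.Homotopic.Quotient x x') (a : Fin g ⊕ Fin g),
        transportFun (univFamilyℂ 𝓜) 1 hU p (ofRatClass _ 1 (fr x a)) = ofRatClass _ 1 (fr x' a)) →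
      (∀ (x : W) (a : Fin g ⊕ Fin g),
        singularCohomology.map ℚ ℚ
          (((AlgPoints.homeomorphOfIso (L := ℂ)
              (fibreAVIso (P' x) ≪≫ (fiberUnivIsoOfIsBaseChangeVia 𝓜 x.1 (P' x) (G x) (Ĝ x) (hbc x)).symm) :
              ((P' x).A.fibre (𝟙 (Spec (CommRingCat.of ℂ)))).toAbelianVariety.Points ℂ ≃ₜ
                ComplexPoints (fiberOver (univFamilyℂ 𝓜) x.1)) :
              C(((P' x).A.fibre (𝟙 (Spec (CommRingCat.of ℂ)))).toAbelianVariety.Points ℂ,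
                ComplexPoints (fiberOver (univFamilyℂ 𝓜) x.1))).comp
            ⟨(mark x).toFun, (mark x).isAnalytification.isHomeomorph.continuous⟩) 1 (fr x a) =
          latticeClass (mark x).Ψ a) →
      ∀ (i : Fin g ⊕ Fin g) (v : Fin g ⊕ Fin g → ℚ) (x₀ : W),
        (P' x₀).A.restrictPt (𝟙 (Spec (CommRingCat.of ℂ))) ((P' x₀).level.σ i) = (mark x₀).r v →
        ∀ x : W, (P' x).A.restrictPt (𝟙 (Spec (CommRingCat.of ℂ))) ((P' x).level.σ i) = (mark x).r v := by
  intro W hW hU P' G Ĝ hbc J mark hγ1 fr hflat hframe i v x₀ hx₀ x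
  classical
  have hN0 : N ≠ 0 := by omega
  -- ### instances for ★ (E2-core): the base and the total space are complex varieties ((F-c′) by base change; the total
  -- space through the smooth proper `f`), `f` is smooth proper of relative dimension `g`
  have hf := UnivFamilyHodgeFrames.isSmoothProjectiveFamily_univFamilyℂ_of_classify 𝓜
  have hMc : IsQuasiProjectiveOver ((Motives.baseChange ℚ ℂ).obj 𝓜.M) :=
    UnivFamilyHodgeFrames.isQuasiProjectiveOver_baseChange_M 𝓜 hMq
  haveI : SmoothOfRelativeDimension g (univFamilyℂ 𝓜).left := hf.smoothOfRelativeDimension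
  haveI : Smooth (univFamilyℂ 𝓜).left := SmoothOfRelativeDimension.smooth g _
  haveI : IsProper (univFamilyℂ 𝓜).left := hf.isProper
  haveI : LocallyOfFiniteType ((Motives.baseChange ℚ ℂ).obj 𝓜.M).hom := hMc.isVarietyPair_ofScheme.locallyOfFiniteType
  haveI : IsSeparated ((Motives.baseChange ℚ ℂ).obj 𝓜.M).hom := hMc.isVarietyPair_ofScheme.isSeparated
  haveI : QuasiCompact ((Motives.baseChange ℚ ℂ).obj 𝓜.M).hom := hMc.isVarietyPair_ofScheme.quasiCompact
  have hXhom : ((Motives.baseChange ℚ ℂ).obj (univTotal 𝓜)).hom =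
      (univFamilyℂ 𝓜).left ≫ ((Motives.baseChange ℚ ℂ).obj 𝓜.M).hom := (Over.w (univFamilyℂ 𝓜)).symm
  haveI : LocallyOfFiniteType ((Motives.baseChange ℚ ℂ).obj (univTotal 𝓜)).hom := by rw [hXhom]; infer_instance
  haveI : IsSeparated ((Motives.baseChange ℚ ℂ).obj (univTotal 𝓜)).hom := by rw [hXhom]; infer_instance
  haveI : QuasiCompact ((Motives.baseChange ℚ ℂ).obj (univTotal 𝓜)).hom := by rw [hXhom]; infer_instance
  haveI : CompactSpace ((Motives.baseChange ℚ ℂ).obj (univTotal 𝓜)).left :=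
    QuasiCompact.compactSpace_of_compactSpace ((Motives.baseChange ℚ ℂ).obj (univTotal 𝓜)).hom
  haveI : CompactSpace ((Motives.baseChange ℚ ℂ).obj 𝓜.M).left :=
    QuasiCompact.compactSpace_of_compactSpace ((Motives.baseChange ℚ ℂ).obj 𝓜.M).hom
  haveI : SecondCountableTopology (ComplexPoints ((Motives.baseChange ℚ ℂ).obj (univTotal 𝓜))) :=
    ComplexPoints.secondCountableTopology_of_compactSpace_holds _
  haveI : SecondCountableTopology (ComplexPoints ((Motives.baseChange ℚ ℂ).obj 𝓜.M)) :=
    ComplexPoints.secondCountableTopology_of_compactSpace_holds _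
  -- ### the pinned identifications and the torus charts `u x := e x ∘ (mark x).toFun`
  let e : ∀ y : W, ((P' y).A.fibre (𝟙 (Spec (CommRingCat.of ℂ)))).toAbelianVariety.Points ℂ ≃ₜ
      ComplexPoints (fiberOver (univFamilyℂ 𝓜) y.1) := fun y ↦
    AlgPoints.homeomorphOfIso (L := ℂ)
      (fibreAVIso (P' y) ≪≫ (fiberUnivIsoOfIsBaseChangeVia 𝓜 y.1 (P' y) (G y) (Ĝ y) (hbc y)).symm)
  let u : ∀ y : W, C(ComplexTorus (mark y).Ψ, ComplexPoints (fiberOver (univFamilyℂ 𝓜) y.1)) := fun y ↦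
    (e y : C(((P' y).A.fibre (𝟙 (Spec (CommRingCat.of ℂ)))).toAbelianVariety.Points ℂ,
        ComplexPoints (fiberOver (univFamilyℂ 𝓜) y.1))).comp
      ⟨(mark y).toFun, (mark y).isAnalytification.isHomeomorph.continuous⟩
  have hu_apply : ∀ (y : W) (t : ComplexTorus (mark y).Ψ), u y t = e y ((mark y).toFun t) := fun _ _ ↦ rfl
  have hu : ∀ y, Function.Bijective (u y) := fun y ↦ (e y).bijective.comp (mark y).bijective
  -- ### the universal section `σᵢ` and `[N]` as `ℚ`-morphisms of the total space, complexified
  let σM : 𝓜.M ⟶ univTotal 𝓜 := Over.homMk (𝓜.univ.level.σ i).left (by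
    change (𝓜.univ.level.σ i).left ≫ 𝓜.univ.A.X.hom ≫ 𝓜.M.hom = 𝓜.M.hom
    rw [← Category.assoc]
    erw [Over.w (𝓜.univ.level.σ i)]
    exact Category.id_comp _)
  have hσM : σM.left = (𝓜.univ.level.σ i).left := rfl
  let nX : univTotal 𝓜 ⟶ univTotal 𝓜 :=
    Over.homMk ((((𝟙 𝓜.univ.A.X : 𝓜.univ.A.X ⟶ 𝓜.univ.A.X) ^ N).left : 𝓜.univ.A.X.left ⟶ 𝓜.univ.A.X.left)) (by
      change _ ≫ 𝓜.univ.A.X.hom ≫ 𝓜.M.hom = 𝓜.univ.A.X.hom ≫ 𝓜.M.hom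
      rw [← Category.assoc, Over.w])
  have hnX : nX.left = (((𝟙 𝓜.univ.A.X : 𝓜.univ.A.X ⟶ 𝓜.univ.A.X) ^ N).left : 𝓜.univ.A.X.left ⟶ 𝓜.univ.A.X.left) :=
    rfl
  have hnXf : (Motives.baseChange ℚ ℂ).map nX ≫ univFamilyℂ 𝓜 = univFamilyℂ 𝓜 := by
    change (Motives.baseChange ℚ ℂ).map nX ≫ (Motives.baseChange ℚ ℂ).map (univFamily 𝓜) =
      (Motives.baseChange ℚ ℂ).map (univFamily 𝓜)
    rw [← Functor.map_comp]
    congr 1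
    ext : 1
    exact Over.w (((𝟙 𝓜.univ.A.X : 𝓜.univ.A.X ⟶ 𝓜.univ.A.X) ^ N))
  -- ### the torsion points `σᵢ(y)` are `toFun [w(y)/N]`
  have hQ : ∀ y : W, ∃ w : Fin g ⊕ Fin g → ℤ,
      (mark y).toFun (ComplexTorus.proj (mark y).Ψ fun a ↦ (w a : ℝ) / N) =
        (P' y).A.restrictPt (𝟙 (Spec (CommRingCat.of ℂ))) ((P' y).level.σ i) := by
    intro y
    obtain ⟨t, ht⟩ := (mark y).bijective.2 ((P' y).A.restrictPt (𝟙 (Spec (CommRingCat.of ℂ))) ((P' y).level.σ i))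
    have hNt : N • t = 0 := by
      apply (mark y).bijective.1
      rw [(mark y).toFun_nsmul, ht, (mark y).toFun_zero]
      exact AbelianSchemeOver.restrictPt_pow_eq_one _ _ ((P' y).level.pow_σ i)
    obtain ⟨w, hw⟩ := exists_eq_proj_intCast_div_of_nsmul_eq_zero (mark y).Ψ hN0 t hNt
    exact ⟨w, by rw [← hw, ht]⟩
  choose w hw using hQ
  -- ### ★ (E2-core): the readings `w(y) mod N` are constant on `W`
  have key : ∀ a, (w x a : ZMod N) = (w x₀ a : ZMod N) := fun a ↦
    torsionReading_const_of_flatFrame_family (univFamilyℂ 𝓜) g d hW hU (fun y ↦ (mark y).Ψ) u hu fr hflat hframe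
      N (by omega) ((Motives.baseChange ℚ ℂ).map nX) hnXf
      (fun y t ↦ by
        rw [hu_apply, hu_apply, (mark y).toFun_nsmul]
        exact (map_fiberι_pinned_pow 𝓜 y.1 (P' y) (G y) (Ĝ y) (hbc y) N nX hnX ((mark y).toFun t)).symm)
      (fun y ↦ AlgPoints.map ((Motives.baseChange ℚ ℂ).map σM) y.1)
      ((AlgPoints.continuous_map _).comp continuous_subtype_val) w
      (fun y ↦ by
        rw [hu_apply, hw y]
        exact (map_fiberι_pinned_restrictPt 𝓜 y.1 (P' y) (G y) (Ĝ y) (hbc y) i σM hσM).symm)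
      x x₀ a
  -- ### at `x₀`: `[w(x₀)/N] = [ṽ]` (injectivity of the uniformisation), hence at `x`
  have h0 : (ComplexTorus.proj (mark x₀).Ψ fun a ↦ (w x₀ a : ℝ) / N) =
      ComplexTorus.proj (mark x₀).Ψ fun a ↦ ((v a : ℚ) : ℝ) := by
    apply (mark x₀).bijective.1
    rw [hw x₀, hx₀, SiegelAdelicMarking.r_eq_toFun_proj_of_γ_eq_one (mark x₀) (hγ1 x₀) v]
  have hx' : (ComplexTorus.proj (mark x).Ψ fun a ↦ (w x₀ a : ℝ) / N) =
      ComplexTorus.proj (mark x).Ψ fun a ↦ ((v a : ℚ) : ℝ) := h0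
  rw [← hw x, proj_intCast_div_eq_of_intCast_eq (mark x).Ψ hN0 key, hx',
    SiegelAdelicMarking.r_eq_toFun_proj_of_γ_eq_one (mark x) (hγ1 x) v]

end Head

end UnivFamilyLevelReadings

end Summit.HodgeConjecture.HodgeConjecture.Theorems

end
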